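import Mathlib
import Literature.AlgebraicGeometry.Resolution.PlaneGermBlowup
import Literature.AlgebraicGeometry.Resolution.FormalCoordinateChange

/-!
# Point blow-ups of plane curve germs: the calculus of transforms, and the primes `x`, `y` of `k[[x, y]]`

Folklore infrastructure about `MvPowerSeries (Fin 2) k` (`x = X 0`, `y = X 1`, `k` a field) in the
vocabulary of `PlaneGermBlowup.lean` (the charts `PlaneGerm.dirChart t = (x, x (t + y))`,
`PlaneGerm.vertChart = (x y, x)` of the point blow-up, the transform germs `PlaneGerm.IsTransform`, the
normal-crossing supports `PlaneGerm.IsNC`) and of `Mathlib.RingTheory.MvPowerSeries.Substitution`, written for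
the successor toolkit of the line `hasse-ridge-face-selection` of the crux `LocalWeightedDrop`
(stmt-ResolutionOfSingularities-8899; file
`Summits/…/Theorems/WeightedInvariantLocalWeightedDropBlowupSuccessorToolkit.lean`).  Sources for the
mathematics: Casas-Alvero, *Singularities of Plane Curves*, §3.1–3.2 (charts of the blow-up, strict and total
transforms); Campillo, *Algebroid curves in positive characteristic*, LNM 813, Ch. III.

* MONOMIAL SUBSTITUTIONS: `(x, x y)` sends the monomial `(p, q)` to `(p + q, q)` and the vertical chart
  `(x y, x)` sends `(p, q)` to `(p + q, p)`; both exponent maps are injective, so coefficients are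
  transported (`coeff_subst_of_prod_eq_monomial`) and no non-zero series is killed
  (`subst_blow_ne_zero`, `subst_vertChart_ne_zero`).
* THE CHART OF SLOPE `t` is the shear `(x, y + t x)` (a formal coordinate change:
  `FormalCoordChange.subst_ne_zero_of_isUnit_det`) followed by `(x, x y)` (`subst_dirChart`), hence
  injective (`subst_dirChart_ne_zero`).
* TRANSFORMS (`IsTransform Φ b D`: `b∘Φ = x^{ord b} · st`, `D = x · st`): existence as soon as `x` divides
  the components of `Φ` (`X_pow_dvd_subst`, `exists_isTransform`, via `MvPowerSeries.coeff_subst` and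
  `MvPowerSeries.X_pow_dvd_iff`), uniqueness (`isTransform_unique`: cancel `x^m`), non-vanishing in an
  injective chart (`isTransform_ne_zero`), multiplicativity (`exists_isTransform_mul`: `subst` is a ring
  map and `MvPowerSeries.order_mul`).
* PRIMES AND NORMAL CROSSINGS: `x` and `y` are prime in `k[[x, y]]` (`prime_X`: killing the variable is a
  ring map whose kernel is the multiples of the variable, `coeff_kill`, `X_dvd_iff_kill_eq_zero`), so by
  `mul_eq_mul_prime_pow` a divisor of `u · x^a · y^c`, `u` a unit, is `u' · x^{a'} · y^{c'}` with `u'` a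
  unit (`exists_eq_of_dvd_normalCrossing`), and normal-crossing support is inherited by divisors
  (`isNC_of_dvd`).

No definitions.  Deliberately NOT here: the finite-branching clause of the toolkit (the tangent
polynomial; it lives with the toolkit), more than two variables, and unique factorisation of `k[[x, y]]`
beyond the primality of the two variables.
-/

namespace Literature.AlgebraicGeometry.Resolution.PlaneGerm

open MvPowerSeries

variable {k : Type*} [Field k]

/-! ### Monomial substitutions: `(x, x y)` and the vertical chart `(x y, x)` -/

/-- Along a substitution sending monomials to monomials injectively, coefficients are transported. [folklore] -/
theorem coeff_subst_of_prod_eq_monomial {Φ : Fin 2 → MvPowerSeries (Fin 2) k} (hΦ : HasSubst Φ)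
    (φ : (Fin 2 →₀ ℕ) → (Fin 2 →₀ ℕ)) (hφ : Function.Injective φ)
    (hprod : ∀ d : Fin 2 →₀ ℕ, (d.prod fun s n => Φ s ^ n) = monomial (φ d) 1)
    (g : MvPowerSeries (Fin 2) k) (d : Fin 2 →₀ ℕ) :
    coeff (φ d) (subst Φ g) = coeff d g := by
  classical
  rw [coeff_subst hΦ, finsum_eq_single _ d]
  · rw [hprod, coeff_monomial_same, smul_eq_mul, mul_one]
  · intro d' hd'
    rw [hprod, coeff_monomial_ne (fun h => hd' (hφ h).symm), smul_zero]

/-- A substitution sending monomials to monomials injectively kills no non-zero series. [folklore] -/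
theorem subst_ne_zero_of_prod_eq_monomial {Φ : Fin 2 → MvPowerSeries (Fin 2) k} (hΦ : HasSubst Φ)
    (φ : (Fin 2 →₀ ℕ) → (Fin 2 →₀ ℕ)) (hφ : Function.Injective φ)
    (hprod : ∀ d : Fin 2 →₀ ℕ, (d.prod fun s n => Φ s ^ n) = monomial (φ d) 1)
    {g : MvPowerSeries (Fin 2) k} (hg : g ≠ 0) : subst Φ g ≠ 0 := by
  intro h0
  apply hg
  ext d
  rw [← coeff_subst_of_prod_eq_monomial hΦ φ hφ hprod g d, h0, map_zero, map_zero]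

/-- The exponent map `(p, q) ↦ (p + q, q)` of `(x, x y)` is injective. [folklore] -/
theorem injective_exp_blow :
    Function.Injective (fun d : Fin 2 →₀ ℕ =>
      (Finsupp.single 0 (d 0 + d 1) + Finsupp.single 1 (d 1) : Fin 2 →₀ ℕ)) := by
  intro d d' h
  have h0 := congrArg (fun f : Fin 2 →₀ ℕ => f 0) h
  have h1 := congrArg (fun f : Fin 2 →₀ ℕ => f 1) h
  simp at h0 h1
  ext i
  fin_cases i
  · show d 0 = d' 0
    omega
  · exact h1

/-- The exponent map `(p, q) ↦ (p + q, p)` of `(x y, x)` is injective. [folklore] -/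
theorem injective_exp_vert :
    Function.Injective (fun d : Fin 2 →₀ ℕ =>
      (Finsupp.single 0 (d 0 + d 1) + Finsupp.single 1 (d 0) : Fin 2 →₀ ℕ)) := by
  intro d d' h
  have h0 := congrArg (fun f : Fin 2 →₀ ℕ => f 0) h
  have h1 := congrArg (fun f : Fin 2 →₀ ℕ => f 1) h
  simp at h0 h1
  ext i
  fin_cases i
  · exact h1
  · show d 1 = d' 1
    omega

/-- `(x, x y)` is substitutable. [folklore] -/
theorem hasSubst_blow : HasSubst (![X 0, X 0 * X 1] : Fin 2 → MvPowerSeries (Fin 2) k) :=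
  hasSubst_of_constantCoeff_zero fun i => by fin_cases i <;> simp [constantCoeff_X]

/-- `(x, x y)` sends the monomial `(p, q)` to the monomial `(p + q, q)`. [folklore] -/
theorem prod_pow_blow (d : Fin 2 →₀ ℕ) :
    (d.prod fun s n => (![X 0, X 0 * X 1] : Fin 2 → MvPowerSeries (Fin 2) k) s ^ n) =
      monomial (Finsupp.single 0 (d 0 + d 1) + Finsupp.single 1 (d 1)) 1 := by
  rw [Finsupp.prod_pow, Fin.prod_univ_two]
  show (X 0 : MvPowerSeries (Fin 2) k) ^ d 0 * (X 0 * X 1) ^ d 1 = _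
  rw [mul_pow, ← mul_assoc, ← pow_add, X_pow_eq, X_pow_eq, monomial_mul_monomial, one_mul]

/-- The vertical chart `(x y, x)` sends the monomial `(p, q)` to the monomial `(p + q, p)`. [folklore] -/
theorem prod_pow_vertChart (d : Fin 2 →₀ ℕ) :
    (d.prod fun s n => PlaneGerm.vertChart k s ^ n) =
      monomial (Finsupp.single 0 (d 0 + d 1) + Finsupp.single 1 (d 0)) 1 := by
  rw [Finsupp.prod_pow, Fin.prod_univ_two, PlaneGerm.vertChart_zero, PlaneGerm.vertChart_one,
    mul_pow, mul_right_comm, ← pow_add, X_pow_eq, X_pow_eq, monomial_mul_monomial, one_mul]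

/-- Coefficients along `(x, x y)`: `coeff (p + q, q) g(x, x y) = coeff (p, q) g`. [folklore] -/
theorem coeff_subst_blow (g : MvPowerSeries (Fin 2) k) (d : Fin 2 →₀ ℕ) :
    coeff (Finsupp.single 0 (d 0 + d 1) + Finsupp.single 1 (d 1))
      (subst (![X 0, X 0 * X 1] : Fin 2 → MvPowerSeries (Fin 2) k) g) = coeff d g :=
  coeff_subst_of_prod_eq_monomial hasSubst_blow _ injective_exp_blow prod_pow_blow g d

/-- Coefficients along the vertical chart: `coeff (p + q, p) g(x y, x) = coeff (p, q) g`. [folklore] -/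
theorem coeff_subst_vertChart (g : MvPowerSeries (Fin 2) k) (d : Fin 2 →₀ ℕ) :
    coeff (Finsupp.single 0 (d 0 + d 1) + Finsupp.single 1 (d 0)) (subst (PlaneGerm.vertChart k) g) =
      coeff d g :=
  coeff_subst_of_prod_eq_monomial PlaneGerm.hasSubst_vertChart _ injective_exp_vert prod_pow_vertChart g d

/-- `(x, x y)` kills no non-zero series. [folklore] -/
theorem subst_blow_ne_zero {g : MvPowerSeries (Fin 2) k} (hg : g ≠ 0) :
    subst (![X 0, X 0 * X 1] : Fin 2 → MvPowerSeries (Fin 2) k) g ≠ 0 :=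
  subst_ne_zero_of_prod_eq_monomial hasSubst_blow _ injective_exp_blow prod_pow_blow hg

/-- The vertical chart kills no non-zero series. [folklore] -/
theorem subst_vertChart_ne_zero {g : MvPowerSeries (Fin 2) k} (hg : g ≠ 0) :
    subst (PlaneGerm.vertChart k) g ≠ 0 :=
  subst_ne_zero_of_prod_eq_monomial PlaneGerm.hasSubst_vertChart _ injective_exp_vert
    prod_pow_vertChart hg

/-! ### The chart of slope `t` is the shear `(x, y + t x)` followed by `(x, x y)` -/

/-- The shear `(x, y + t x)` has zero constant terms. [folklore] -/
theorem constantCoeff_shearX (t : k) :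
    ∀ i, constantCoeff ((![X 0, X 1 + C t * X 0] : Fin 2 → MvPowerSeries (Fin 2) k) i) = 0 := by
  intro i
  fin_cases i
  · exact constantCoeff_X 0
  · show constantCoeff (X 1 + C t * X 0) = 0
    rw [map_add, map_mul, constantCoeff_X, constantCoeff_X, mul_zero, add_zero]

/-- The shear `(x, y + t x)` has linear part of determinant `1`. [folklore] -/
theorem isUnit_det_shearX (t : k) :
    IsUnit (FormalCoordChange.linMat
      (![X 0, X 1 + C t * X 0] : Fin 2 → MvPowerSeries (Fin 2) k)).det := by
  classical
  rw [Matrix.det_fin_two]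
  simp [FormalCoordChange.linMat, coeff_X, coeff_C_mul, Finsupp.single_eq_single_iff]

/-- `b(x, x(t + y))` is `b(x, y + t x)` followed by `(x, x y)`. [folklore] -/
theorem subst_dirChart (t : k) (b : MvPowerSeries (Fin 2) k) :
    subst (PlaneGerm.dirChart t) b =
      subst (![X 0, X 0 * X 1] : Fin 2 → MvPowerSeries (Fin 2) k)
        (subst (![X 0, X 1 + C t * X 0] : Fin 2 → MvPowerSeries (Fin 2) k) b) := by
  have hΨ := (hasSubst_blow (k := k))
  rw [subst_comp_subst_apply (hasSubst_of_constantCoeff_zero (constantCoeff_shearX t)) hΨ]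
  congr 1
  funext s
  fin_cases s
  · show (X 0 : MvPowerSeries (Fin 2) k) = subst ![X 0, X 0 * X 1] (X 0)
    rw [subst_X hΨ]
    rfl
  · show (X 0 * (C t + X 1) : MvPowerSeries (Fin 2) k) = subst ![X 0, X 0 * X 1] (X 1 + C t * X 0)
    rw [subst_add hΨ, subst_mul hΨ, subst_C, subst_X hΨ, subst_X hΨ]
    show (X 0 * (C t + X 1) : MvPowerSeries (Fin 2) k) = X 0 * X 1 + C t * X 0
    ring

/-- The chart of slope `t` kills no non-zero series. [folklore] -/
theorem subst_dirChart_ne_zero (t : k) {b : MvPowerSeries (Fin 2) k} (hb : b ≠ 0) :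
    subst (PlaneGerm.dirChart t) b ≠ 0 := by
  rw [subst_dirChart]
  exact subst_blow_ne_zero
    (FormalCoordChange.subst_ne_zero_of_isUnit_det (constantCoeff_shearX t) (isUnit_det_shearX t) hb)

/-! ### Existence, uniqueness, non-vanishing and multiplicativity of transforms -/

/-- If `x` divides every component of `Φ` and `m ≤ ord b` then `x^m ∣ b∘Φ`. [folklore] -/
theorem X_pow_dvd_subst {Φ : Fin 2 → MvPowerSeries (Fin 2) k} (hΦ : HasSubst Φ)
    (hX : ∀ i, (X 0 : MvPowerSeries (Fin 2) k) ∣ Φ i) {b : MvPowerSeries (Fin 2) k} {m : ℕ}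
    (hm : (m : ℕ∞) ≤ b.order) : (X 0 : MvPowerSeries (Fin 2) k) ^ m ∣ subst Φ b := by
  classical
  rw [X_pow_dvd_iff]
  intro e he
  rw [coeff_subst hΦ]
  apply finsum_eq_zero_of_forall_eq_zero
  intro d
  by_cases hd : d.degree < m
  · rw [coeff_of_lt_order (lt_of_lt_of_le (by exact_mod_cast hd) hm), zero_smul]
  · have hdvd : (X 0 : MvPowerSeries (Fin 2) k) ^ m ∣ d.prod fun s n => Φ s ^ n := by
      rw [Finsupp.prod_pow, Fin.prod_univ_two]
      have h2 : (X 0 : MvPowerSeries (Fin 2) k) ^ d.degree ∣ Φ 0 ^ d 0 * Φ 1 ^ d 1 := by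
        rw [Finsupp.degree_eq_sum, Fin.sum_univ_two, pow_add]
        exact mul_dvd_mul (pow_dvd_pow_of_dvd (hX 0) _) (pow_dvd_pow_of_dvd (hX 1) _)
      exact (pow_dvd_pow _ (not_lt.mp hd)).trans h2
    rw [X_pow_dvd_iff.mp hdvd e he, smul_zero]

/-- `x` divides both components of the chart of slope `t`. [folklore] -/
theorem X_dvd_dirChart (t : k) : ∀ i, (X 0 : MvPowerSeries (Fin 2) k) ∣ PlaneGerm.dirChart t i := by
  intro i
  fin_cases i
  · exact dvd_rfl
  · exact dvd_mul_right _ _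

/-- `x` divides both components of the vertical chart. [folklore] -/
theorem X_dvd_vertChart : ∀ i, (X 0 : MvPowerSeries (Fin 2) k) ∣ PlaneGerm.vertChart k i := by
  intro i
  fin_cases i
  · exact dvd_mul_right _ _
  · exact dvd_rfl

/-- EXISTENCE of the transform germ in a chart whose components are divisible by `x`. [folklore] -/
theorem exists_isTransform {Φ : Fin 2 → MvPowerSeries (Fin 2) k} (hΦ : HasSubst Φ)
    (hX : ∀ i, (X 0 : MvPowerSeries (Fin 2) k) ∣ Φ i) {b : MvPowerSeries (Fin 2) k} (hb : b ≠ 0) :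
    ∃ D, PlaneGerm.IsTransform Φ b D := by
  have hm : b.order = (b.order.toNat : ℕ∞) := (ne_zero_iff_order_finite.mp hb).symm
  obtain ⟨st, hst⟩ := X_pow_dvd_subst hΦ hX (m := b.order.toNat) hm.symm.le
  exact ⟨X 0 * st, b.order.toNat, st, hm, hst, rfl⟩

/-- UNIQUENESS of the transform germ given the chart. [folklore] -/
theorem isTransform_unique {Φ : Fin 2 → MvPowerSeries (Fin 2) k} {b D D' : MvPowerSeries (Fin 2) k}
    (h : PlaneGerm.IsTransform Φ b D) (h' : PlaneGerm.IsTransform Φ b D') : D = D' := by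
  obtain ⟨m, st, hm, hsub, rfl⟩ := h
  obtain ⟨m', st', hm', hsub', rfl⟩ := h'
  have hmm : m = m' := by
    rw [hm] at hm'
    exact_mod_cast hm'
  subst hmm
  rw [hsub] at hsub'
  rw [mul_left_cancel₀ (pow_ne_zero m (FormalCoordChange.X_ne_zero' (0 : Fin 2))) hsub']

/-- NON-VANISHING: in an injective chart the transform germ is non-zero. [folklore] -/
theorem isTransform_ne_zero {Φ : Fin 2 → MvPowerSeries (Fin 2) k} {b D : MvPowerSeries (Fin 2) k}
    (hinj : ∀ f : MvPowerSeries (Fin 2) k, f ≠ 0 → subst Φ f ≠ 0)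
    (h : PlaneGerm.IsTransform Φ b D) : D ≠ 0 := by
  obtain ⟨m, st, hm, hsub, rfl⟩ := h
  have hb : b ≠ 0 := by
    rintro rfl
    rw [order_zero] at hm
    exact (ENat.coe_ne_top m) hm.symm
  have hst : st ≠ 0 := by
    rintro rfl
    exact hinj b hb (by rw [hsub, mul_zero])
  exact mul_ne_zero (FormalCoordChange.X_ne_zero' _) hst

/-- MULTIPLICATIVITY: transforms of `b` and `e` multiply to a transform of `b * e`, so the transform of
`b` divides a transform of `b * e`. [folklore] -/
theorem exists_isTransform_mul {Φ : Fin 2 → MvPowerSeries (Fin 2) k} (hΦ : HasSubst Φ)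
    {b e D E : MvPowerSeries (Fin 2) k} (hb : PlaneGerm.IsTransform Φ b D)
    (he : PlaneGerm.IsTransform Φ e E) :
    ∃ D', PlaneGerm.IsTransform Φ (b * e) D' ∧ D ∣ D' := by
  obtain ⟨m, st, hm, hsub, rfl⟩ := hb
  obtain ⟨m', st', hm', hsub', rfl⟩ := he
  refine ⟨X 0 * (st * st'), ⟨m + m', st * st', ?_, ?_, rfl⟩, ⟨st', by ring⟩⟩
  · rw [order_mul, hm, hm', Nat.cast_add]
  · rw [subst_mul hΦ, hsub, hsub']
    ring

/-! ### `x` and `y` are prime; divisors of normal crossings -/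

/-- The family killing `X i` (`X i ↦ 0`, `X j ↦ X j`) is substitutable. [folklore] -/
theorem hasSubst_kill (i : Fin 2) :
    HasSubst (fun j : Fin 2 => if j = i then (0 : MvPowerSeries (Fin 2) k) else X j) :=
  hasSubst_of_constantCoeff_zero fun j => by
    by_cases h : j = i <;> simp [h, constantCoeff_X]

/-- COEFFICIENTS AFTER KILLING `X i`: the monomials free of `X i` survive, the others die. [folklore] -/
theorem coeff_kill (i : Fin 2) (f : MvPowerSeries (Fin 2) k) (m : Fin 2 →₀ ℕ) :
    coeff m (subst (fun j : Fin 2 => if j = i then (0 : MvPowerSeries (Fin 2) k) else X j) f) =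
      if m i = 0 then coeff m f else 0 := by
  -- adapted from `Literature.AlgebraicGeometry.Resolution.FormalShear.coeff_kill` (the case `i = 1`)
  classical
  have hprod : ∀ d : Fin 2 →₀ ℕ,
      (d.prod fun s n => (if s = i then (0 : MvPowerSeries (Fin 2) k) else X s) ^ n) =
        if d i = 0 then monomial d 1 else 0 := by
    intro d
    by_cases hdi : d i = 0
    · rw [if_pos hdi, monomial_one_eq]
      apply Finsupp.prod_congr
      intro s hs
      have hsi : s ≠ i := by
        rintro rfl
        exact (Finsupp.mem_support_iff.mp hs) hdi
      rw [if_neg hsi]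
    · rw [if_neg hdi, Finsupp.prod, Finset.prod_eq_zero (Finsupp.mem_support_iff.mpr hdi)]
      rw [if_pos rfl, zero_pow hdi]
  rw [coeff_subst (hasSubst_kill i), finsum_eq_single _ m]
  · rw [hprod]
    split_ifs with hm
    · rw [coeff_monomial_same, smul_eq_mul, mul_one]
    · rw [map_zero, smul_zero]
  · intro d hd
    rw [hprod]
    split_ifs with hd'
    · rw [coeff_monomial_ne (Ne.symm hd), smul_zero]
    · rw [map_zero, smul_zero]

/-- `X i ∣ f` iff `f` dies when `X i` is killed. [folklore] -/
theorem X_dvd_iff_kill_eq_zero (i : Fin 2) (f : MvPowerSeries (Fin 2) k) :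
    (X i : MvPowerSeries (Fin 2) k) ∣ f ↔
      subst (fun j : Fin 2 => if j = i then (0 : MvPowerSeries (Fin 2) k) else X j) f = 0 := by
  rw [X_dvd_iff]
  constructor
  · intro h
    ext m
    rw [coeff_kill, map_zero]
    split_ifs with hm
    · exact h m hm
    · rfl
  · intro h m hm
    have h' := congrArg (coeff m) h
    rwa [coeff_kill, if_pos hm, map_zero] at h'

/-- The variables `x`, `y` of `k[[x, y]]` are prime. [folklore] -/
theorem prime_X (i : Fin 2) : Prime (X i : MvPowerSeries (Fin 2) k) := by
  refine ⟨FormalCoordChange.X_ne_zero' i, fun hu => ?_, fun f g hfg => ?_⟩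
  · rw [isUnit_iff_constantCoeff, constantCoeff_X] at hu
    exact not_isUnit_zero hu
  · rw [X_dvd_iff_kill_eq_zero, subst_mul (hasSubst_kill i), mul_eq_zero] at hfg
    rcases hfg with h | h
    · exact Or.inl ((X_dvd_iff_kill_eq_zero i f).mpr h)
    · exact Or.inr ((X_dvd_iff_kill_eq_zero i g).mpr h)

/-- DIVISORS OF NORMAL CROSSINGS: a divisor of `u · x^a · y^c`, `u` a unit, is `u' · x^{a'} · y^{c'}`
with `u'` a unit. [folklore] -/
theorem exists_eq_of_dvd_normalCrossing {g u : MvPowerSeries (Fin 2) k} {a c : ℕ}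
    (hu : constantCoeff u ≠ 0) (h : g ∣ u * X 0 ^ a * X 1 ^ c) :
    ∃ (u' : MvPowerSeries (Fin 2) k) (a' c' : ℕ), constantCoeff u' ≠ 0 ∧ g = u' * X 0 ^ a' * X 1 ^ c' := by
  obtain ⟨h', hh⟩ := h
  obtain ⟨i, -, v, w, -, hbc, hg, -⟩ := mul_eq_mul_prime_pow (prime_X 1) hh.symm
  obtain ⟨i', -, v', w', -, hbc', hv, -⟩ := mul_eq_mul_prime_pow (prime_X 0) hbc.symm
  refine ⟨v', i', i, ?_, by rw [hg, hv]⟩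
  have hunit : IsUnit u := isUnit_iff_constantCoeff.mpr (isUnit_iff_ne_zero.mpr hu)
  have hv'u : IsUnit v' := isUnit_of_dvd_unit ⟨w', hbc'⟩ hunit
  exact (isUnit_iff_constantCoeff.mp hv'u).ne_zero

/-- NC IS INHERITED BY DIVISORS. [folklore] -/
theorem isNC_of_dvd {b d : MvPowerSeries (Fin 2) k} (hbd : b ∣ d) (hd : PlaneGerm.IsNC d) :
    PlaneGerm.IsNC b := by
  obtain ⟨Φ, u, a, c, hΦ0, hdet, hu, hsub⟩ := hd
  obtain ⟨e, rfl⟩ := hbd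
  have hΦ : HasSubst Φ := hasSubst_of_constantCoeff_zero hΦ0
  have hdvd : subst Φ b ∣ u * X 0 ^ a * X 1 ^ c := ⟨subst Φ e, by rw [← hsub, subst_mul hΦ]⟩
  obtain ⟨u', a', c', hu', heq⟩ := exists_eq_of_dvd_normalCrossing hu hdvd
  exact ⟨Φ, u', a', c', hΦ0, hdet, hu', heq⟩

end Literature.AlgebraicGeometry.Resolution.PlaneGerm
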